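import Mathlib
import HarnessLib
import Summits.ValiantsHypothesis.Statement
import Summits.ValiantsHypothesis.ValiantsHypothesis.Theses.SymmetryDial

/-!
# SymmetryDial — A₁ (`AffineSupportTheorem`) is exactly a support theorem for subgroups of `GL_d(𝔽₂)`

Decomposition workshop decomp-valiant, cycle 1 (VALIANT), lens 1, generation 4.  LADDER-Valiant rung 0:
nothing here proves VP ≠ VNP.  Helper theorems toward route item `stmt-ValiantsHypothesis-23710`
(`AffineSupportTheorem`, child A₁ of `SymHardAffine`); the route's statements are UNCHANGED — everything
below is an equivalence with, or an implication into, the item as filed.  All kernel, no `sorry`.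

* `mem_AGL_iff`: the defining set of the route's model of `AGL_d(𝔽₂)` (permutations of `𝔽₂^d` preserving
  3-term sums) is already a subgroup, so membership in its `Subgroup.closure` is the 3-sum identity; an
  origin-fixing element is additive (`AGL.map_add`).
* `affineSupportTheorem_iff_linear`: the AFFINE → LINEAR reduction is elementary — for `K ≤ AGL` of index
  `≤ n^c + c` the origin-fixing subgroup `K ⊓ Stab(0)` has index `≤ (n^c + c)·n ≤ n^(c+2) + (c+2)`
  (`Subgroup.index_inf_le`, `[AGL : Stab 0] ≤ n`) and `Fix(U, W) ⊆ K ⊓ Stab(0) ⊆ K`; no translation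
  cocycle is needed (this corrects the g3 skeleton: `stub_reduceToPointed` is not a genuine stub).
* `affineSupportTheorem_iff_linearSupportGL`: transport along `Stab(0) ≅ GL_d(𝔽₂)`, realised as the
  bijective homomorphism `glOfStab : Stab(0) →* ((Fin d → ZMod 2) ≃ₗ[ZMod 2] (Fin d → ZMod 2))` (an additive
  bijection of an `𝔽₂`-space is linear): A₁ is EQUIVALENT to `LinearSupportGL`, the same statement for
  subgroups of the honest general linear group, and to its asymptotic form `LinearSupportGLEventually`
  (small `d` are free: every subgroup contains `Fix(𝔽₂^d, ⊤) = {1}`).  This is the object the workshop's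
  A1-SUPPORT-CENSUS (GAP; `AGL_d(2)`, `d ≤ 6`; `GL_7(2)`) measures and the one Aschbacher–Liebeck address.
-/

set_option linter.dupNamespace false

namespace Summit.ValiantsHypothesis.ValiantsHypothesis.Theorems.SymmetryDialAffineReduction

open Summit.ValiantsHypothesis.ValiantsHypothesis.Theses.SymmetryDial

/-- The defining set of the route's model of `AGL_d(𝔽₂)`: permutations of `𝔽₂^d` preserving 3-term sums. -/
abbrev affSet (d : ℕ) : Set (Equiv.Perm (Fin d → Fin 2)) :=
  {σ : Equiv.Perm (Fin d → Fin 2) | ∀ x y z : Fin d → Fin 2, σ (x + y + z) = σ x + σ y + σ z}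

/-- The route's symmetry group `AGL_d(𝔽₂)`, as a subtype of `Equiv.Perm (Fin d → Fin 2)`. -/
abbrev AGL (d : ℕ) : Type := ↥(Subgroup.closure (affSet d))

/-- `affSet d` is already a subgroup of `Equiv.Perm (Fin d → Fin 2)`. -/
def affSubgroup (d : ℕ) : Subgroup (Equiv.Perm (Fin d → Fin 2)) where
  carrier := affSet d
  one_mem' := fun _ _ _ => rfl
  mul_mem' := by
    intro σ τ hσ hτ x y z
    have hσ' : ∀ x y z : Fin d → Fin 2, σ (x + y + z) = σ x + σ y + σ z := hσ
    have hτ' : ∀ x y z : Fin d → Fin 2, τ (x + y + z) = τ x + τ y + τ z := hτ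
    show σ (τ (x + y + z)) = σ (τ x) + σ (τ y) + σ (τ z)
    rw [hτ', hσ']
  inv_mem' := by
    intro σ hσ x y z
    have hσ' : ∀ x y z : Fin d → Fin 2, σ (x + y + z) = σ x + σ y + σ z := hσ
    apply σ.injective
    show σ (σ⁻¹ (x + y + z)) = σ (σ⁻¹ x + σ⁻¹ y + σ⁻¹ z)
    rw [hσ']
    simp only [Equiv.Perm.inv_def, Equiv.apply_symm_apply]

/-- The closure in the route's definition is the set itself. -/
theorem closure_affSet (d : ℕ) : Subgroup.closure (affSet d) = affSubgroup d :=
  (affSubgroup d).closure_eq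

/-- Membership in the model is the 3-sum identity (no closure needed). -/
theorem mem_AGL_iff {d : ℕ} (σ : Equiv.Perm (Fin d → Fin 2)) :
    σ ∈ Subgroup.closure (affSet d) ↔ ∀ x y z : Fin d → Fin 2, σ (x + y + z) = σ x + σ y + σ z := by
  rw [closure_affSet]
  rfl

/-- Elements of the model preserve 3-term sums. -/
theorem AGL.map_add₃ {d : ℕ} (σ : AGL d) (x y z : Fin d → Fin 2) :
    σ.1 (x + y + z) = σ.1 x + σ.1 y + σ.1 z :=
  (mem_AGL_iff σ.1).1 σ.2 x y z

/-- An origin-fixing element of the model is additive (hence `𝔽₂`-linear). -/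
theorem AGL.map_add {d : ℕ} (σ : AGL d) (h0 : σ.1 0 = 0) (x y : Fin d → Fin 2) :
    σ.1 (x + y) = σ.1 x + σ.1 y := by
  have h := AGL.map_add₃ σ x y 0
  rwa [add_zero, h0, add_zero] at h

/-- The point stabiliser `Stab(0) ≅ GL_d(𝔽₂)` inside the model. -/
abbrev Stab0 (d : ℕ) : Subgroup (AGL d) := MulAction.stabilizer (AGL d) (0 : Fin d → Fin 2)

/-- Membership in `Stab(0)`. -/
theorem mem_Stab0_iff {d : ℕ} (σ : AGL d) : σ ∈ Stab0 d ↔ σ.1 0 = 0 :=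
  MulAction.mem_stabilizer_iff

/-- `[AGL : Stab(0)] ≤ n = 2^d` (orbit–stabiliser: the orbit of `0` lies in `𝔽₂^d`). -/
theorem index_Stab0_le (d : ℕ) : (Stab0 d).index ≤ 2 ^ d := by
  have hcard : Nat.card (Fin d → Fin 2) = 2 ^ d := by
    rw [Nat.card_eq_fintype_card, Fintype.card_fun, Fintype.card_fin, Fintype.card_fin]
  rw [MulAction.index_stabilizer, ← hcard]
  exact Set.ncard_le_card _

/-- `[AGL : Stab(0)] ≥ 1` (finite group). -/
theorem one_le_index_Stab0 (d : ℕ) : 1 ≤ (Stab0 d).index :=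
  Nat.one_le_iff_ne_zero.2 Subgroup.index_ne_zero_of_finite

/-- `K ≤ AGL_d(𝔽₂)` contains the flag-let fixator `Fix(U, W)` (elements fixing `U` pointwise and acting
trivially modulo `W`) for some `|U| ≤ k` and `[𝔽₂^d : W] ≤ 2^k`. -/
def ContainsFix (d k : ℕ) (K : Subgroup (AGL d)) : Prop :=
  ∃ (U : Finset (Fin d → Fin 2)) (W : AddSubgroup (Fin d → Fin 2)), U.card ≤ k ∧ W.index ≤ 2 ^ k ∧
    ∀ σ : AGL d, (∀ u ∈ U, σ.1 u = u) → (∀ v : Fin d → Fin 2, σ.1 v + v ∈ W) → σ ∈ K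

/-- `ContainsFix` is monotone in the subgroup. -/
theorem containsFix_mono {d k : ℕ} {K K' : Subgroup (AGL d)} (hKK' : K ≤ K')
    (h : ContainsFix d k K) : ContainsFix d k K' := by
  obtain ⟨U, W, hU, hW, hfix⟩ := h
  exact ⟨U, W, hU, hW, fun σ hu hv => hKK' (hfix σ hu hv)⟩

/-- A₁ unfolded (definitional). -/
theorem affineSupportTheorem_iff :
    AffineSupportTheorem ↔
      ∀ c : ℕ, ∃ k : ℕ, ∀ (d : ℕ) (K : Subgroup (AGL d)), K.index ≤ (2 ^ d) ^ c + c → ContainsFix d k K :=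
  Iff.rfl

/-- The LINEAR case of A₁ inside the model: the same support statement for ORIGIN-FIXING subgroups only
(this is the statement of the g3 stub `stub_pointedCase`). -/
def LinearSupportModel : Prop :=
  ∀ c : ℕ, ∃ k : ℕ, ∀ (d : ℕ) (K : Subgroup (AGL d)),
    (∀ σ ∈ K, σ.1 0 = 0) → K.index ≤ (2 ^ d) ^ c + c → ContainsFix d k K

/-- A₁ ⟹ its linear case (a special case). -/
theorem linearSupportModel_of_affine (h : AffineSupportTheorem) : LinearSupportModel := by
  intro c
  obtain ⟨k, hk⟩ := (affineSupportTheorem_iff.1 h) c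
  exact ⟨k, fun d K _ hK => hk d K hK⟩

/-- Index bookkeeping: `(n^c + c)·n ≤ n^(c+2) + (c+2)` for `n ≥ 1`. -/
theorem index_arith (n c : ℕ) (hn : 1 ≤ n) : (n ^ c + c) * n ≤ n ^ (c + 2) + (c + 2) := by
  rcases Nat.eq_or_lt_of_le hn with h | h
  · subst h
    simp
  · have h2 : 2 ≤ n := h
    have hc : c * n ≤ n ^ c * n := Nat.mul_le_mul_right n (Nat.lt_pow_self h).le
    calc (n ^ c + c) * n = n ^ c * n + c * n := by ring
      _ ≤ n ^ c * n + n ^ c * n := Nat.add_le_add_left hc _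
      _ = 2 * (n ^ c * n) := by ring
      _ ≤ n * (n ^ c * n) := Nat.mul_le_mul_right _ h2
      _ = n ^ (c + 2) := by ring
      _ ≤ n ^ (c + 2) + (c + 2) := Nat.le_add_right _ _

/-- AFFINE ⟸ LINEAR: intersect with the point stabiliser.  `K ⊓ Stab(0)` is origin-fixing, has index
`≤ [AGL : K]·[AGL : Stab 0] ≤ (n^c + c)·n ≤ n^(c+2) + (c+2)`, and `Fix(U, W) ⊆ K ⊓ Stab(0) ⊆ K`. -/
theorem affineSupportTheorem_of_linear (h : LinearSupportModel) : AffineSupportTheorem := by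
  rw [affineSupportTheorem_iff]
  intro c
  obtain ⟨k, hk⟩ := h (c + 2)
  refine ⟨k, fun d K hK => ?_⟩
  have h0 : ∀ σ ∈ K ⊓ Stab0 d, σ.1 0 = 0 := fun σ hσ =>
    (mem_Stab0_iff σ).1 (Subgroup.mem_inf.1 hσ).2
  have hidx : (K ⊓ Stab0 d).index ≤ (2 ^ d) ^ (c + 2) + (c + 2) :=
    calc (K ⊓ Stab0 d).index ≤ K.index * (Stab0 d).index := Subgroup.index_inf_le
      _ ≤ ((2 ^ d) ^ c + c) * 2 ^ d := Nat.mul_le_mul hK (index_Stab0_le d)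
      _ ≤ (2 ^ d) ^ (c + 2) + (c + 2) := index_arith _ _ Nat.one_le_two_pow
  exact containsFix_mono inf_le_left (hk d _ h0 hidx)

/-- **A₁ ⟺ its linear (origin-fixing) case.** -/
theorem affineSupportTheorem_iff_linear : AffineSupportTheorem ↔ LinearSupportModel :=
  ⟨linearSupportModel_of_affine, affineSupportTheorem_of_linear⟩

/-- `𝔽₂^d` as a `ZMod 2`-module. -/
abbrev V₂ (d : ℕ) : Type := Fin d → ZMod 2

/-- `GL_d(𝔽₂)` as the group of `ZMod 2`-linear automorphisms of `𝔽₂^d`. -/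
abbrev GL₂ (d : ℕ) : Type := V₂ d ≃ₗ[ZMod 2] V₂ d

/-- `H ≤ GL_d(𝔽₂)` contains the flag-let fixator `Fix(U, W) = {g | g|_U = id, (g + 1)(𝔽₂^d) ⊆ W}` for some
`|U| ≤ k`, `[𝔽₂^d : W] ≤ 2^k`. -/
def ContainsFixGL (d k : ℕ) (H : Subgroup (GL₂ d)) : Prop :=
  ∃ (U : Finset (V₂ d)) (W : AddSubgroup (V₂ d)), U.card ≤ k ∧ W.index ≤ 2 ^ k ∧
    ∀ g : GL₂ d, (∀ u ∈ U, g u = u) → (∀ v : V₂ d, g v + v ∈ W) → g ∈ H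

/-- **A₁ in `GL_d(𝔽₂)` clothing** (the linear support theorem): for every `c` there is `k` such that every
subgroup of `GL_d(𝔽₂)` of index `≤ 2^(cd) + c` contains a flag-let fixator of budget `k`. -/
def LinearSupportGL : Prop :=
  ∀ c : ℕ, ∃ k : ℕ, ∀ (d : ℕ) (H : Subgroup (GL₂ d)), H.index ≤ (2 ^ d) ^ c + c → ContainsFixGL d k H

/-- Its asymptotic form (large `d` only). -/
def LinearSupportGLEventually : Prop :=
  ∀ c : ℕ, ∃ k d₀ : ℕ, ∀ d : ℕ, d₀ ≤ d → ∀ H : Subgroup (GL₂ d),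
    H.index ≤ (2 ^ d) ^ c + c → ContainsFixGL d k H

/-- `GL_d(𝔽₂)` is finite. -/
theorem finite_GL₂ (d : ℕ) : Finite (GL₂ d) :=
  Finite.of_injective (fun g : GL₂ d => (g : V₂ d → V₂ d)) DFunLike.coe_injective

/-- `ContainsFixGL` is monotone in the budget. -/
theorem containsFixGL_mono_k {d k k' : ℕ} (hkk' : k ≤ k') {H : Subgroup (GL₂ d)}
    (h : ContainsFixGL d k H) : ContainsFixGL d k' H := by
  obtain ⟨U, W, hU, hW, hfix⟩ := h
  exact ⟨U, W, hU.trans hkk', hW.trans (Nat.pow_le_pow_right (by norm_num) hkk'), hfix⟩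

/-- Small dimensions are free: for `d < d₀` every subgroup contains `Fix(𝔽₂^d, ⊤) = {1}` at budget `2^d₀`. -/
theorem containsFixGL_of_lt {d d₀ : ℕ} (hd : d < d₀) (H : Subgroup (GL₂ d)) :
    ContainsFixGL d (2 ^ d₀) H := by
  classical
  refine ⟨Finset.univ, ⊤, ?_, ?_, fun g hu _ => ?_⟩
  · rw [Finset.card_univ, Fintype.card_fun, ZMod.card, Fintype.card_fin]
    exact Nat.pow_le_pow_right (by norm_num) hd.le
  · rw [AddSubgroup.index_top]
    exact Nat.one_le_two_pow
  · have hg : g = 1 := LinearEquiv.ext fun v => by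
      rw [hu v (Finset.mem_univ v)]
      rfl
    rw [hg]
    exact H.one_mem

/-- SMALL-`d` ABSORPTION: the asymptotic form is equivalent to the uniform one. -/
theorem linearSupportGL_iff_eventually : LinearSupportGL ↔ LinearSupportGLEventually := by
  constructor
  · intro h c
    obtain ⟨k, hk⟩ := h c
    exact ⟨k, 0, fun d _ H hH => hk d H hH⟩
  · intro h c
    obtain ⟨k, d₀, hk⟩ := h c
    refine ⟨k + 2 ^ d₀, fun d H hH => ?_⟩
    rcases lt_or_ge d d₀ with hd | hd
    · exact containsFixGL_mono_k (Nat.le_add_left _ _) (containsFixGL_of_lt hd H)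
    · exact containsFixGL_mono_k (Nat.le_add_right _ _) (hk d hd H hH)

/-- Coordinate identification `(Fin d → Fin 2) ≃+ (Fin d → ZMod 2)`. -/
def coordEquiv (d : ℕ) : (Fin d → Fin 2) ≃+ V₂ d :=
  AddEquiv.piCongrRight fun _ => (ZMod.finEquiv 2).toAddEquiv

/-- The additive automorphism of `𝔽₂^d` underlying an origin-fixing model element. -/
def addEquivOfStab {d : ℕ} (σ : ↥(Stab0 d)) : (Fin d → Fin 2) ≃+ (Fin d → Fin 2) :=
  { (σ.1.1 : Equiv.Perm (Fin d → Fin 2)) with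
    map_add' := AGL.map_add σ.1 ((mem_Stab0_iff σ.1).1 σ.2) }

/-- `addEquivOfStab` acts as the underlying permutation. -/
@[simp] theorem addEquivOfStab_apply {d : ℕ} (σ : ↥(Stab0 d)) (v : Fin d → Fin 2) :
    addEquivOfStab σ v = σ.1.1 v := rfl

/-- An additive self-equivalence of a `ZMod 2`-module is `ZMod 2`-linear. -/
def linearOfAddEquiv {d : ℕ} (e : V₂ d ≃+ V₂ d) : GL₂ d :=
  LinearEquiv.ofLinear ((e : V₂ d →+ V₂ d).toZModLinearMap 2) ((e.symm : V₂ d →+ V₂ d).toZModLinearMap 2)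
    (LinearMap.ext fun x => by simp) (LinearMap.ext fun x => by simp)

/-- `linearOfAddEquiv e` acts as `e`. -/
@[simp] theorem linearOfAddEquiv_apply {d : ℕ} (e : V₂ d ≃+ V₂ d) (x : V₂ d) :
    linearOfAddEquiv e x = e x := rfl

/-- **The isomorphism `Stab(0) ≅ GL_d(𝔽₂)`** as a (bijective, see below) group homomorphism. -/
def glOfStab (d : ℕ) : ↥(Stab0 d) →* GL₂ d where
  toFun σ := linearOfAddEquiv (((coordEquiv d).symm.trans (addEquivOfStab σ)).trans (coordEquiv d))
  map_one' := LinearEquiv.ext fun x => by simp [LinearEquiv.coe_one]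
  map_mul' σ τ := LinearEquiv.ext fun x => by simp

/-- `glOfStab` is conjugation of the underlying permutation by the coordinate identification. -/
@[simp] theorem glOfStab_apply {d : ℕ} (σ : ↥(Stab0 d)) (x : V₂ d) :
    glOfStab d σ x = coordEquiv d (σ.1.1 ((coordEquiv d).symm x)) := rfl

/-- Inverse construction: a linear automorphism gives an origin-fixing model element. -/
def stabOfGL {d : ℕ} (g : GL₂ d) : ↥(Stab0 d) :=
  ⟨⟨((coordEquiv d).trans (g.toAddEquiv.trans (coordEquiv d).symm)).toEquiv,
      (mem_AGL_iff _).2 (fun x y z => by simp [map_add])⟩,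
    (mem_Stab0_iff _).2 (by simp)⟩

/-- `stabOfGL g` acts as `g` conjugated back. -/
@[simp] theorem stabOfGL_apply {d : ℕ} (g : GL₂ d) (v : Fin d → Fin 2) :
    (stabOfGL g).1.1 v = (coordEquiv d).symm (g (coordEquiv d v)) := rfl

/-- `glOfStab ∘ stabOfGL = id`. -/
theorem glOfStab_stabOfGL {d : ℕ} (g : GL₂ d) : glOfStab d (stabOfGL g) = g :=
  LinearEquiv.ext fun x => by simp

/-- `glOfStab` is injective. -/
theorem glOfStab_injective (d : ℕ) : Function.Injective (glOfStab d) := by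
  intro σ τ h
  apply Subtype.ext
  apply Subtype.ext
  apply Equiv.ext
  intro v
  have := LinearEquiv.congr_fun h (coordEquiv d v)
  simpa using this

/-- `glOfStab` is bijective: `Stab(0) ≅ GL_d(𝔽₂)`. -/
theorem glOfStab_bijective (d : ℕ) : Function.Bijective (glOfStab d) :=
  ⟨glOfStab_injective d, fun g => ⟨stabOfGL g, glOfStab_stabOfGL g⟩⟩

/-- MODEL ⟹ GL (pull `H ≤ GL_d(𝔽₂)` back to the origin-fixing subgroup `glOfStab⁻¹ H` of the model). -/
theorem linearSupportGL_of_model (h : LinearSupportModel) : LinearSupportGL := by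
  classical
  intro c
  obtain ⟨k, hk⟩ := h (c + 2)
  refine ⟨k, fun d H hH => ?_⟩
  let K₁ : Subgroup ↥(Stab0 d) := H.comap (glOfStab d)
  let K : Subgroup (AGL d) := K₁.map (Stab0 d).subtype
  have hKle : K ≤ Stab0 d := by
    rintro _ ⟨τ, _, rfl⟩
    exact τ.2
  have h0 : ∀ σ ∈ K, σ.1 0 = 0 := fun σ hσ => (mem_Stab0_iff σ).1 (hKle hσ)
  have hK₁idx : K₁.index = H.index := H.index_comap_of_surjective (glOfStab_bijective d).2
  have hrel : K.relIndex (Stab0 d) = K₁.index := by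
    rw [Subgroup.relIndex, Subgroup.subgroupOf,
      Subgroup.comap_map_eq_self_of_injective (Stab0 d).subtype_injective]
  have hKidx : K.index ≤ (2 ^ d) ^ (c + 2) + (c + 2) := by
    rw [← Subgroup.relIndex_mul_index hKle, hrel, hK₁idx]
    exact (Nat.mul_le_mul hH (index_Stab0_le d)).trans (index_arith _ _ Nat.one_le_two_pow)
  obtain ⟨U, W, hU, hW, hfix⟩ := hk d K h0 hKidx
  refine ⟨U.image (coordEquiv d), W.comap (coordEquiv d).symm.toAddMonoidHom, ?_, ?_,
    fun g hu hv => ?_⟩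
  · exact Finset.card_image_le.trans hU
  · rw [W.index_comap_of_surjective (f := (coordEquiv d).symm.toAddMonoidHom)
      (coordEquiv d).symm.surjective]
    exact hW
  · have hσK : ((stabOfGL g : ↥(Stab0 d)) : AGL d) ∈ K := by
      apply hfix
      · intro u hu'
        have hgu := hu (coordEquiv d u) (Finset.mem_image_of_mem _ hu')
        simp [hgu]
      · intro v
        have hgv := hv (coordEquiv d v)
        rw [AddSubgroup.mem_comap] at hgv
        simpa [map_add] using hgv
    have hσK₁ : stabOfGL g ∈ K₁ := (Subgroup.mem_map_iff_mem (Stab0 d).subtype_injective).1 hσK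
    have hgH : glOfStab d (stabOfGL g) ∈ H := Subgroup.mem_comap.1 hσK₁
    rwa [glOfStab_stabOfGL] at hgH

/-- GL ⟹ MODEL (push an origin-fixing `K` forward along `glOfStab`; add `0` to the fixed set). -/
theorem linearSupportModel_of_GL (h : LinearSupportGL) : LinearSupportModel := by
  classical
  intro c
  obtain ⟨k, hk⟩ := h c
  refine ⟨k + 1, fun d K h0 hK => ?_⟩
  have hKle : K ≤ Stab0 d := fun σ hσ => (mem_Stab0_iff σ).2 (h0 σ hσ)
  let K₁ : Subgroup ↥(Stab0 d) := K.subgroupOf (Stab0 d)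
  let H : Subgroup (GL₂ d) := K₁.map (glOfStab d)
  have hHidx : H.index ≤ (2 ^ d) ^ c + c := by
    have h1 : H.index = K.relIndex (Stab0 d) :=
      Subgroup.index_map_of_bijective (glOfStab_bijective d) K₁
    have h2 : K.relIndex (Stab0 d) * (Stab0 d).index = K.index := Subgroup.relIndex_mul_index hKle
    calc H.index = K.relIndex (Stab0 d) := h1
      _ ≤ K.relIndex (Stab0 d) * (Stab0 d).index := Nat.le_mul_of_pos_right _ (one_le_index_Stab0 d)
      _ = K.index := h2
      _ ≤ (2 ^ d) ^ c + c := hK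
  obtain ⟨U, W, hU, hW, hfix⟩ := hk d H hHidx
  refine ⟨insert 0 (U.image (coordEquiv d).symm), W.comap (coordEquiv d).toAddMonoidHom, ?_, ?_,
    fun σ hu hv => ?_⟩
  · exact (Finset.card_insert_le _ _).trans (Nat.succ_le_succ (Finset.card_image_le.trans hU))
  · rw [W.index_comap_of_surjective (f := (coordEquiv d).toAddMonoidHom) (coordEquiv d).surjective]
    exact hW.trans (Nat.pow_le_pow_right (by norm_num) (Nat.le_succ k))
  · have hσ0 : σ.1 0 = 0 := hu 0 (Finset.mem_insert_self _ _)
    let σ' : ↥(Stab0 d) := ⟨σ, (mem_Stab0_iff σ).2 hσ0⟩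
    have hH : glOfStab d σ' ∈ H := by
      apply hfix
      · intro u hu'
        have hσu := hu ((coordEquiv d).symm u)
          (Finset.mem_insert_of_mem (Finset.mem_image_of_mem _ hu'))
        simp [σ', hσu]
      · intro v
        have hσv := hv ((coordEquiv d).symm v)
        rw [AddSubgroup.mem_comap] at hσv
        simpa [map_add, σ'] using hσv
    have hσ' : σ' ∈ K₁ := (Subgroup.mem_map_iff_mem (glOfStab_injective d)).1 hH
    exact Subgroup.mem_subgroupOf.1 hσ'

/-- The linear case of A₁ ⟺ the support theorem for `GL_d(𝔽₂)`. -/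
theorem linearSupportModel_iff_GL : LinearSupportModel ↔ LinearSupportGL :=
  ⟨linearSupportGL_of_model, linearSupportModel_of_GL⟩

/-- **A₁ is exactly the linear support theorem for `GL_d(𝔽₂)`.** -/
theorem affineSupportTheorem_iff_linearSupportGL : AffineSupportTheorem ↔ LinearSupportGL :=
  affineSupportTheorem_iff_linear.trans linearSupportModel_iff_GL

/-- … and exactly its asymptotic form (small `d` absorbed). -/
theorem affineSupportTheorem_iff_linearSupportGLEventually :
    AffineSupportTheorem ↔ LinearSupportGLEventually :=
  affineSupportTheorem_iff_linearSupportGL.trans linearSupportGL_iff_eventually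

/-- The usable direction, by name: an asymptotic support theorem for `GL_d(𝔽₂)` proves the route item. -/
theorem affineSupportTheorem_of_linearSupportGLEventually (h : LinearSupportGLEventually) :
    AffineSupportTheorem :=
  affineSupportTheorem_iff_linearSupportGLEventually.2 h

end Summit.ValiantsHypothesis.ValiantsHypothesis.Theorems.SymmetryDialAffineReduction
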